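import Mathlib
import Summits.MatrixMultiplication.MatrixMultiplication.Theses.SemilatticeSTPP
import Summits.MatrixMultiplication.MatrixMultiplication.Theorems.SemilatticeSTPPThesisCountingBounds

/-!
# Line `registered` of crux `SemilatticeSTPP.Thesis` (stmt-MatrixMultiplication-5969):
# no semilattice volume beat in hosts with at most nine elements

Hosts here are SEMILATTICES = finite commutative idempotent monoids.  For a monoid-TPP family in iff-form
(`α x * β y = γ z ⟺` the indices match) with block shapes `⟨aᵢ, bᵢ, cᵢ⟩`, the counting toolkit
(`card_ge_gamma_add_alpha_of_idempotent`, `card_ge_gamma_add_beta_of_idempotent`) gives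
`Σ_{1 ≤ bᵢ} aᵢcᵢ + Σ_{2 ≤ bᵢ, 1 ≤ cᵢ} aᵢbᵢ ≤ |M|` and `Σ_{1 ≤ bᵢ} aᵢcᵢ + Σ_{2 ≤ bᵢ, 1 ≤ aᵢ} bᵢcᵢ ≤ |M|`.
Adding them, the per-block weight
`sᵢ := 2·[1 ≤ bᵢ] aᵢcᵢ + [2 ≤ bᵢ ∧ 1 ≤ cᵢ] aᵢbᵢ + [2 ≤ bᵢ ∧ 1 ≤ aᵢ] bᵢcᵢ` satisfies `Σ sᵢ ≤ 2|M|`.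

* `two_mul_volume_le_weight_or_nineteen_le_weight` — the block arithmetic: either `2aᵢbᵢcᵢ ≤ sᵢ`, or
  `19 ≤ sᵢ` (the degenerate shapes `b ≤ 1`, `a = 0`, `c = 0` give `sᵢ = 2aᵢbᵢcᵢ`; otherwise
  `sᵢ = 2ac + ab + bc`, and `2abc > 2ac + ab + bc` forces `2ac + ab + bc ≥ 19`, with equality exactly at
  `(a,b,c) = (1,5,2), (2,5,1)` — a finite check).
* `volume_le_card_of_card_le_nine` — hence a family beating volume (`Σ aᵢbᵢcᵢ > |M|`) has a block with
  `19 ≤ sᵢ ≤ Σ sⱼ ≤ 2|M|`, i.e. `|M| ≥ 10`: no semilattice host with `|M| ≤ 9` carries a volume beat.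

Mathlib + the route file + the counting-bounds file only; no cited facts; sorry-free.
-/

set_option linter.dupNamespace false
-- (single-conjunct summit: the namespace repeats `MatrixMultiplication`)

namespace Summit.MatrixMultiplication.MatrixMultiplication.Theorems.SemilatticeSTPPThesis

/-- **Block arithmetic, non-degenerate case.**  For `1 ≤ a`, `2 ≤ b`, `1 ≤ c`: either
`2abc ≤ 2ac + ab + bc` or `19 ≤ 2ac + ab + bc`.  Indeed `2ac + ab + bc ≤ 18` bounds `a, c ≤ 9`, and for each
such pair the claim is linear in `b`. [folklore] -/
theorem two_mul_mul_mul_le_or_nineteen_le (a b c : ℕ) (ha : 1 ≤ a) (hb : 2 ≤ b) (hc : 1 ≤ c) :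
    2 * (a * b * c) ≤ 2 * (a * c) + a * b + b * c ∨ 19 ≤ 2 * (a * c) + a * b + b * c := by
  by_cases h : 2 * (a * c) + a * b + b * c ≤ 18
  · left
    have ha9 : a ≤ 9 := by nlinarith
    have hc9 : c ≤ 9 := by nlinarith
    interval_cases a <;> interval_cases c <;> omega
  · right
    omega

/-- **Block arithmetic.**  With the per-block weight
`s = 2·[1 ≤ b] ac + [2 ≤ b ∧ 1 ≤ c] ab + [2 ≤ b ∧ 1 ≤ a] bc`: either `2abc ≤ s` or `19 ≤ s`.
The degenerate shapes `b = 0`, `b = 1`, `a = 0`, `c = 0` all give `s = 2abc`; otherwise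
`s = 2ac + ab + bc` and `two_mul_mul_mul_le_or_nineteen_le` applies. [folklore] -/
theorem two_mul_volume_le_weight_or_nineteen_le_weight (a b c : ℕ) :
    2 * (a * b * c) ≤ 2 * (if 1 ≤ b then a * c else 0) + (if 2 ≤ b ∧ 1 ≤ c then a * b else 0)
        + (if 2 ≤ b ∧ 1 ≤ a then b * c else 0) ∨
      19 ≤ 2 * (if 1 ≤ b then a * c else 0) + (if 2 ≤ b ∧ 1 ≤ c then a * b else 0)
        + (if 2 ≤ b ∧ 1 ≤ a then b * c else 0) := by
  by_cases hb : 2 ≤ b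
  · by_cases ha : 1 ≤ a
    · by_cases hc : 1 ≤ c
      · have hb1 : 1 ≤ b := le_trans one_le_two hb
        simp only [hb1, hb, ha, hc, and_self, if_true]
        exact two_mul_mul_mul_le_or_nineteen_le a b c ha hb hc
      · left
        obtain rfl : c = 0 := by omega
        simp
    · left
      obtain rfl : a = 0 := by omega
      simp
  · left
    have hb2 : b < 2 := not_le.mp hb
    interval_cases b <;> simp

/-- **No semilattice volume beat below ten elements.**  In a finite commutative idempotent host `M` with
`|M| ≤ 9`, every monoid-TPP family (iff-form) has volume `Σ aᵢbᵢcᵢ ≤ |M|`.  Proof: the two counting bounds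
`card_ge_gamma_add_alpha_of_idempotent` and `card_ge_gamma_add_beta_of_idempotent` add up to `Σ sᵢ ≤ 2|M|` for
the block weights `sᵢ = 2·[1 ≤ bᵢ] aᵢcᵢ + [2 ≤ bᵢ ∧ 1 ≤ cᵢ] aᵢbᵢ + [2 ≤ bᵢ ∧ 1 ≤ aᵢ] bᵢcᵢ`; if every block has
`2aᵢbᵢcᵢ ≤ sᵢ` then `2·Σ aᵢbᵢcᵢ ≤ 2|M|`, and otherwise some block has `19 ≤ sᵢ ≤ Σ sⱼ ≤ 2|M| ≤ 18`
(`two_mul_volume_le_weight_or_nineteen_le_weight`), absurd. [folklore] -/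
theorem volume_le_card_of_card_le_nine :
    ∀ (M : Type) [CommMonoid M] [Fintype M], (∀ v : M, v * v = v) →
      ∀ (p : ℕ) (a b c : Fin p → ℕ) (α : (Σ i, Fin (a i) × Fin (b i)) → M)
        (β : (Σ i, Fin (b i) × Fin (c i)) → M) (γ : (Σ i, Fin (a i) × Fin (c i)) → M),
        (∀ x y z, α x * β y = γ z ↔
          (z.1 = x.1 ∧ x.1 = y.1 ∧ (z.2.1 : ℕ) = x.2.1 ∧ (x.2.2 : ℕ) = y.2.1 ∧ (z.2.2 : ℕ) = y.2.2)) →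
        Fintype.card M ≤ 9 → ∑ i, a i * b i * c i ≤ Fintype.card M := by
  intro M _ _ hid p a b c α β γ htpp hM
  have hA := card_ge_gamma_add_alpha_of_idempotent M hid p a b c α β γ htpp
  have hB := card_ge_gamma_add_beta_of_idempotent M hid p a b c α β γ htpp
  -- the per-block weights `sᵢ` and their total `Σ sᵢ ≤ 2|M|`
  have hsum : ∑ i, (2 * (if 1 ≤ b i then a i * c i else 0) + (if 2 ≤ b i ∧ 1 ≤ c i then a i * b i else 0)
      + (if 2 ≤ b i ∧ 1 ≤ a i then b i * c i else 0)) ≤ 2 * Fintype.card M := by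
    rw [Finset.sum_add_distrib, Finset.sum_add_distrib, ← Finset.mul_sum]
    omega
  by_cases hall : ∀ i, 2 * (a i * b i * c i) ≤ 2 * (if 1 ≤ b i then a i * c i else 0)
      + (if 2 ≤ b i ∧ 1 ≤ c i then a i * b i else 0) + (if 2 ≤ b i ∧ 1 ≤ a i then b i * c i else 0)
  · -- every block is dominated by its weight: `2·Σ aᵢbᵢcᵢ ≤ Σ sᵢ ≤ 2|M|`
    have hV : 2 * ∑ i, a i * b i * c i ≤ ∑ i, (2 * (if 1 ≤ b i then a i * c i else 0)
        + (if 2 ≤ b i ∧ 1 ≤ c i then a i * b i else 0) + (if 2 ≤ b i ∧ 1 ≤ a i then b i * c i else 0)) := by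
      rw [Finset.mul_sum]
      exact Finset.sum_le_sum fun i _ => hall i
    omega
  · -- some block has weight `≥ 19`, so `2|M| ≥ 19`, i.e. `|M| ≥ 10`
    obtain ⟨i, hi⟩ := not_forall.mp hall
    have h19 : 19 ≤ 2 * (if 1 ≤ b i then a i * c i else 0) + (if 2 ≤ b i ∧ 1 ≤ c i then a i * b i else 0)
        + (if 2 ≤ b i ∧ 1 ≤ a i then b i * c i else 0) :=
      (two_mul_volume_le_weight_or_nineteen_le_weight (a i) (b i) (c i)).resolve_left hi
    have hle : 2 * (if 1 ≤ b i then a i * c i else 0) + (if 2 ≤ b i ∧ 1 ≤ c i then a i * b i else 0)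
        + (if 2 ≤ b i ∧ 1 ≤ a i then b i * c i else 0) ≤ ∑ j, (2 * (if 1 ≤ b j then a j * c j else 0)
        + (if 2 ≤ b j ∧ 1 ≤ c j then a j * b j else 0) + (if 2 ≤ b j ∧ 1 ≤ a j then b j * c j else 0)) :=
      Finset.single_le_sum (f := fun j => 2 * (if 1 ≤ b j then a j * c j else 0)
        + (if 2 ≤ b j ∧ 1 ≤ c j then a j * b j else 0) + (if 2 ≤ b j ∧ 1 ≤ a j then b j * c j else 0))
        (fun j _ => Nat.zero_le _) (Finset.mem_univ i)
    omega

end Summit.MatrixMultiplication.MatrixMultiplication.Theorems.SemilatticeSTPPThesis
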